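import Mathlib
import Literature.GroupTheory.ArithmeticGroups.Rattaggi2004.Gamma35Ravel
import Literature.GroupTheory.DiffuseGroups.Bowditch2000

/-!
# `Γ_{3,5}` is not diffuse (hence not left-orderable)

This file turns the `decide` certificate of `Gamma35Ravel.lean` (20 words in the quaternion letters of
[cite: Rattaggi2004, Example 28] with non-extremality witnesses, an identity check in `ℍ[ℤ]`) into a
statement about an honest group.  Let `PHQ := ℍ(ℚ)^× / ℚ^×` (units of the rational quaternions modulo
nonzero scalars) and let `Gamma35 ≤ PHQ` be the subgroup generated by the classes of the five letters
`a₁, a₂, b₁, b₂, b₃`; by [cite: Rattaggi2004, Example 28, §3] this subgroup is (isomorphic to) the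
torsion-free `(6,4)`-lattice `Γ_{3,5}` — that identification is CITED, not proved here.  We prove:

* `cls_mul`, `cls_star_eq_inv`, `cls_eq_one_of_isScalar` : the class map `ℍ[ℤ] ∖ {0} → PHQ` is
  multiplicative, sends conjugates to inverses and nonzero scalars to `1`;
* `gamma35_not_diffuse : ¬ Diffuse Gamma35` — the classes of the 20 words form a ravel inside `Gamma35`
  (Bowditch's extremal points, `Literature.GroupTheory.DiffuseGroups`), via the certificate lemma
  `not_diffuse_subgroup_of_witnesses`; and `gamma35_not_leftOrdered` : `Gamma35` carries no left-invariant
  linear order compatible with its multiplication (left-ordered groups are diffuse, [cite: Bowditch2000, §1]).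

Scope (as refereed in the `pub-kaplansky` packet): this is NOT a non-unique-product pair and says nothing
about zero divisors; whether `Γ_{3,5}` has unique products is open ([cite: KionkeRaimbault2016, Question 1]
asks for a non-diffuse group with unique products).
-/

namespace Literature.GroupTheory.ArithmeticGroups.Rattaggi2004

open Quaternion Literature.GroupTheory.DiffuseGroups
open scoped Pointwise

/-- Base change `ℍ[ℤ] → ℍ[ℚ]` on components. [folklore] -/
def toHQ (x : HZ) : ℍ[ℚ] := ⟨x.re, x.imI, x.imJ, x.imK⟩

/-- Component of `toHQ`. [folklore] -/
@[simp] theorem toHQ_re (x : HZ) : (toHQ x).re = x.re := rfl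
/-- Component of `toHQ`. [folklore] -/
@[simp] theorem toHQ_imI (x : HZ) : (toHQ x).imI = x.imI := rfl
/-- Component of `toHQ`. [folklore] -/
@[simp] theorem toHQ_imJ (x : HZ) : (toHQ x).imJ = x.imJ := rfl
/-- Component of `toHQ`. [folklore] -/
@[simp] theorem toHQ_imK (x : HZ) : (toHQ x).imK = x.imK := rfl

/-- `toHQ` is multiplicative. [folklore] -/
theorem toHQ_mul (x y : HZ) : toHQ (x * y) = toHQ x * toHQ y := by
  ext <;> simp [toHQ] <;> ring

/-- `toHQ` commutes with conjugation. [folklore] -/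
theorem toHQ_star (x : HZ) : toHQ (star x) = star (toHQ x) := by
  ext <;> simp [toHQ]

/-- `toHQ x = 0 ↔ x = 0`. [folklore] -/
theorem toHQ_eq_zero_iff (x : HZ) : toHQ x = 0 ↔ x = 0 := by
  constructor
  · intro h
    obtain ⟨h1, h2, h3, h4⟩ := QuaternionAlgebra.ext_iff.mp h
    simp [toHQ] at h1 h2 h3 h4
    ext <;> simp [h1, h2, h3, h4]
  · rintro rfl
    ext <;> simp [toHQ]

/-- `toHQ` of a nonzero quaternion is nonzero. [folklore] -/
theorem toHQ_ne_zero {x : HZ} (hx : x ≠ 0) : toHQ x ≠ 0 :=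
  fun h => hx ((toHQ_eq_zero_iff x).mp h)

/-- `ℍ[ℤ]` has no zero divisors (seen inside the division ring `ℍ[ℚ]`). [folklore] -/
theorem mul_ne_zero' {x y : HZ} (hx : x ≠ 0) (hy : y ≠ 0) : x * y ≠ 0 := by
  intro h0
  have h1 : toHQ x * toHQ y = 0 := by
    rw [← toHQ_mul, h0]
    exact (toHQ_eq_zero_iff 0).mpr rfl
  rcases mul_eq_zero.mp h1 with h | h
  · exact toHQ_ne_zero hx h
  · exact toHQ_ne_zero hy h

/-- The nonzero scalars `ℚ^× ≤ ℍ(ℚ)^×`. [folklore] -/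
def scalars : Subgroup (ℍ[ℚ])ˣ := (Units.map ((algebraMap ℚ ℍ[ℚ] : ℚ →+* ℍ[ℚ]) : ℚ →* ℍ[ℚ])).range

/-- Membership in `scalars`: the underlying quaternion is a (nonzero) rational scalar. [folklore] -/
theorem mem_scalars_iff (u : (ℍ[ℚ])ˣ) :
    u ∈ scalars ↔ ∃ q : ℚ, (Quaternion.coe q : ℍ[ℚ]) = (u : ℍ[ℚ]) := by
  constructor
  · rintro ⟨q, rfl⟩
    exact ⟨(q : ℚ), rfl⟩
  · rintro ⟨q, hq⟩
    have hq0 : q ≠ 0 := by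
      rintro rfl
      exact u.ne_zero (by rw [← hq]; exact Quaternion.coe_zero)
    refine ⟨Units.mk0 q hq0, Units.ext ?_⟩
    exact hq

/-- Scalars are central, so the subgroup is normal. [folklore] -/
instance scalars_normal : (scalars).Normal := by
  refine ⟨fun n hn g => ?_⟩
  obtain ⟨q, hq⟩ := (mem_scalars_iff n).mp hn
  rw [mem_scalars_iff]
  refine ⟨q, ?_⟩
  have hc : (g : ℍ[ℚ]) * (Quaternion.coe q : ℍ[ℚ]) = (Quaternion.coe q : ℍ[ℚ]) * (g : ℍ[ℚ]) :=
    (Quaternion.coe_commutes q (g : ℍ[ℚ])).symm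
  calc (Quaternion.coe q : ℍ[ℚ])
        = (Quaternion.coe q : ℍ[ℚ]) * ((g : ℍ[ℚ]) * ((g⁻¹ : (ℍ[ℚ])ˣ) : ℍ[ℚ])) := by
          rw [Units.mul_inv, mul_one]
    _ = ((g : ℍ[ℚ]) * (Quaternion.coe q : ℍ[ℚ])) * ((g⁻¹ : (ℍ[ℚ])ˣ) : ℍ[ℚ]) := by rw [hc, mul_assoc]
    _ = ((g * n * g⁻¹ : (ℍ[ℚ])ˣ) : ℍ[ℚ]) := by rw [Units.val_mul, Units.val_mul, ← hq]

/-- `PHQ = ℍ(ℚ)^× / ℚ^×`, the ambient group of Rattaggi's quaternion lattices. [cite: Rattaggi2004, §3] -/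
abbrev PHQ : Type := (ℍ[ℚ])ˣ ⧸ scalars

/-- The class in `PHQ` of a nonzero Lipschitz quaternion. [folklore] -/
def cls (x : HZ) (hx : x ≠ 0) : PHQ := QuotientGroup.mk (Units.mk0 (toHQ x) (toHQ_ne_zero hx))

/-- `cls` is multiplicative. [folklore] -/
theorem cls_mul (x y : HZ) (hx : x ≠ 0) (hy : y ≠ 0) (hxy : x * y ≠ 0) :
    cls (x * y) hxy = cls x hx * cls y hy := by
  unfold cls
  rw [← QuotientGroup.mk_mul]
  congr 1
  apply Units.ext
  simp [toHQ_mul]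

/-- A nonzero scalar has trivial class. [folklore] -/
theorem cls_eq_one_of_isScalar (x : HZ) (hx : x ≠ 0) (hs : IsScalar x) : cls x hx = 1 := by
  unfold cls
  rw [QuotientGroup.eq_one_iff, mem_scalars_iff]
  obtain ⟨_, h2, h3, h4⟩ := hs
  refine ⟨(x.re : ℚ), ?_⟩
  ext <;> simp [toHQ, h2, h3, h4, Quaternion.re_coe, Quaternion.imI_coe, Quaternion.imJ_coe,
    Quaternion.imK_coe]

/-- Conjugation preserves being nonzero. [folklore] -/
theorem star_ne_zero' {x : HZ} (hx : x ≠ 0) : star x ≠ 0 := by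
  intro h
  apply hx
  simpa using congrArg star h

/-- `star x * x` is the nonzero scalar `N(x)` for `x ≠ 0`. [folklore] -/
theorem isScalar_star_mul_self {x : HZ} (hx : x ≠ 0) : IsScalar (star x * x) := by
  refine ⟨?_, ?_, ?_, ?_⟩
  · simp only [QuaternionAlgebra.re_mul, QuaternionAlgebra.re_star, QuaternionAlgebra.imI_star,
      QuaternionAlgebra.imJ_star, QuaternionAlgebra.imK_star]
    intro h
    apply hx
    have h' : x.re * x.re + x.imI * x.imI + x.imJ * x.imJ + x.imK * x.imK = 0 := by linarith
    have hre : x.re = 0 := by nlinarith [sq_nonneg x.re, sq_nonneg x.imI, sq_nonneg x.imJ, sq_nonneg x.imK]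
    have hI : x.imI = 0 := by nlinarith [sq_nonneg x.re, sq_nonneg x.imI, sq_nonneg x.imJ, sq_nonneg x.imK]
    have hJ : x.imJ = 0 := by nlinarith [sq_nonneg x.re, sq_nonneg x.imI, sq_nonneg x.imJ, sq_nonneg x.imK]
    have hK : x.imK = 0 := by nlinarith [sq_nonneg x.re, sq_nonneg x.imI, sq_nonneg x.imJ, sq_nonneg x.imK]
    ext <;> simp [hre, hI, hJ, hK]
  · simp only [QuaternionAlgebra.imI_mul, QuaternionAlgebra.re_star, QuaternionAlgebra.imI_star,
      QuaternionAlgebra.imJ_star, QuaternionAlgebra.imK_star]; ring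
  · simp only [QuaternionAlgebra.imJ_mul, QuaternionAlgebra.re_star, QuaternionAlgebra.imI_star,
      QuaternionAlgebra.imJ_star, QuaternionAlgebra.imK_star]; ring
  · simp only [QuaternionAlgebra.imK_mul, QuaternionAlgebra.re_star, QuaternionAlgebra.imI_star,
      QuaternionAlgebra.imJ_star, QuaternionAlgebra.imK_star]; ring

/-- Conjugate = inverse in `PHQ`. [folklore] -/
theorem cls_star_eq_inv (x : HZ) (hx : x ≠ 0) : cls (star x) (star_ne_zero' hx) = (cls x hx)⁻¹ := by
  apply eq_inv_of_mul_eq_one_left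
  rw [← cls_mul (star x) x (star_ne_zero' hx) hx (mul_ne_zero' (star_ne_zero' hx) hx)]
  exact cls_eq_one_of_isScalar _ _ (isScalar_star_mul_self hx)

/-- If the classes agree then the quaternions are projectively equal (`x ȳ` scalar). [folklore] -/
theorem projEq_of_cls_eq {x y : HZ} (hx : x ≠ 0) (hy : y ≠ 0) (h : cls x hx = cls y hy) :
    ProjEq x y := by
  have hsy := star_ne_zero' hy
  have hxy : x * star y ≠ 0 := mul_ne_zero' hx hsy
  have h1 : cls (x * star y) hxy = 1 := by
    rw [cls_mul x (star y) hx hsy hxy, cls_star_eq_inv y hy, h, mul_inv_cancel]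
  unfold cls at h1
  rw [QuotientGroup.eq_one_iff, mem_scalars_iff] at h1
  obtain ⟨q, hq⟩ := h1
  have hq' : toHQ (x * star y) = (Quaternion.coe q : ℍ[ℚ]) := by
    rw [hq]; rfl
  obtain ⟨e1, e2, e3, e4⟩ := QuaternionAlgebra.ext_iff.mp hq'
  have e1' : ((x * star y).re : ℚ) = q := e1
  have e2' : ((x * star y).imI : ℚ) = 0 := e2
  have e3' : ((x * star y).imJ : ℚ) = 0 := e3
  have e4' : ((x * star y).imK : ℚ) = 0 := e4
  refine ⟨?_, by exact_mod_cast e2', by exact_mod_cast e3', by exact_mod_cast e4'⟩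
  intro h0
  have hq0 : q = 0 := by rw [← e1']; exact_mod_cast h0
  apply hxy
  have : toHQ (x * star y) = 0 := by
    rw [hq', hq0]; exact Quaternion.coe_zero
  exact (toHQ_eq_zero_iff _).mp this

/-- The letters generate `Γ_{3,5}` inside `PHQ` (Rattaggi's embedding; the identification with the
abstract `(6,4)`-lattice is [cite: Rattaggi2004, Example 28, §3], not proved here). -/
def letter : Fin 5 → HZ := ![a₁, a₂, b₁, b₂, b₃]

/-- The five letters are nonzero quaternions. [cite: Rattaggi2004, Example 28] -/
theorem letter_ne_zero : ∀ l, letter l ≠ 0 := by decide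

/-- `Γ_{3,5}` as a subgroup of `PHQ`. [cite: Rattaggi2004, Example 28] -/
def Gamma35 : Subgroup PHQ := Subgroup.closure (Set.range fun l => cls (letter l) (letter_ne_zero l))

/-- Words in the letters (`true` = inverse letter, read as the conjugate quaternion). [folklore] -/
def evalHZ : List (Fin 5 × Bool) → HZ
  | [] => 1
  | (l, false) :: w => letter l * evalHZ w
  | (l, true) :: w => star (letter l) * evalHZ w

/-- Every word evaluates to a nonzero quaternion. [folklore] -/
theorem evalHZ_ne_zero : ∀ w, evalHZ w ≠ 0
  | [] => by decide
  | (l, false) :: w =>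
      show letter l * evalHZ w ≠ 0 from mul_ne_zero' (letter_ne_zero l) (evalHZ_ne_zero w)
  | (l, true) :: w =>
      show star (letter l) * evalHZ w ≠ 0 from
        mul_ne_zero' (star_ne_zero' (letter_ne_zero l)) (evalHZ_ne_zero w)

/-- The class of every word lies in `Gamma35`. [folklore] -/
theorem cls_evalHZ_mem : ∀ w, cls (evalHZ w) (evalHZ_ne_zero w) ∈ Gamma35
  | [] => by
      have : cls (evalHZ []) (evalHZ_ne_zero []) = 1 :=
        cls_eq_one_of_isScalar _ _ (by decide)
      rw [this]; exact Gamma35.one_mem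
  | (l, false) :: w => by
      have : cls (evalHZ ((l, false) :: w)) (evalHZ_ne_zero _) =
          cls (letter l) (letter_ne_zero l) * cls (evalHZ w) (evalHZ_ne_zero w) := by
        simp only [evalHZ]; exact cls_mul _ _ _ _ _
      rw [this]
      exact Gamma35.mul_mem (Subgroup.subset_closure ⟨l, rfl⟩) (cls_evalHZ_mem w)
  | (l, true) :: w => by
      have : cls (evalHZ ((l, true) :: w)) (evalHZ_ne_zero _) =
          (cls (letter l) (letter_ne_zero l))⁻¹ * cls (evalHZ w) (evalHZ_ne_zero w) := by
        simp only [evalHZ]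
        rw [← cls_star_eq_inv]; exact cls_mul _ _ _ _ _
      rw [this]
      exact Gamma35.mul_mem (Gamma35.inv_mem (Subgroup.subset_closure ⟨l, rfl⟩)) (cls_evalHZ_mem w)

/-- The 20 ravel words of `Gamma35Ravel.lean` as letter words (indices `0..4` = `a₁ a₂ b₁ b₂ b₃`). [folklore] -/
def words : Fin 20 → List (Fin 5 × Bool) := ![
  [(3, true), (2, false)], [(4, true), (2, false)], [(2, false), (3, true)], [(2, false), (4, true)],
  [(2, false), (3, false)], [(2, false), (4, false)], [(3, false), (2, false)], [(4, false), (2, false)],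
  [(0, true), (1, false)], [(1, true), (0, true)], [(0, false), (1, true)], [(1, false), (0, false)],
  [(0, true), (0, true), (2, false)], [(0, true), (1, true), (4, true)], [(1, true), (1, true), (2, false)],
  [(1, true), (0, false), (3, true)], [(0, false), (0, false), (2, false)], [(0, false), (1, false), (4, false)],
  [(1, false), (0, true), (3, false)], [(1, false), (1, false), (2, false)]]

/-- The words evaluate to the list `ravelList` of `Gamma35Ravel.lean`. [folklore] -/
theorem evalHZ_words : ∀ i : Fin 20, evalHZ (words i) = ravelList.get ⟨i, by simp [ravelList]⟩ := by
  decide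

/-- Witness indices `j, k` (from the table of `Gamma35Ravel.ravel`). [folklore] -/
def J : Fin 20 → Fin 20 := ![16, 14, 13, 17, 15, 13, 12, 12, 1, 0, 5, 4, 1, 3, 0, 2, 7, 5, 4, 6]
/-- Witness indices `k`. [folklore] -/
def K : Fin 20 → Fin 20 := ![19, 16, 18, 18, 17, 15, 14, 19, 3, 2, 7, 6, 8, 8, 9, 9, 10, 10, 11, 11]

/-- The certificate, index form: `nonExtremal (w i) (w (J i)) (w (K i))` for all `i`. [cite: Bowditch2000, §1] -/
theorem nonExtremal_words : ∀ i : Fin 20,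
    nonExtremal (evalHZ (words i)) (evalHZ (words (J i))) (evalHZ (words (K i))) := by
  decide

/-- The ravel family in `PHQ`. [folklore] -/
def ravelFam (i : Fin 20) : PHQ := cls (evalHZ (words i)) (evalHZ_ne_zero _)

/-- The ravel family lies in `Gamma35`. [folklore] -/
theorem ravelFam_mem (i : Fin 20) : ravelFam i ∈ Gamma35 := cls_evalHZ_mem _

/-- Witness `b ≠ a` in `PHQ` (from `¬ ProjEq`). [cite: Bowditch2000, §1] -/
theorem ravelFam_ne (i : Fin 20) : ravelFam (J i) ≠ ravelFam i := by
  intro h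
  exact (nonExtremal_words i).1 (projEq_of_cls_eq _ _ h)

/-- Witness relation `b a⁻¹ c = a` in `PHQ` (from `IsScalar (b ā c ā)`). [cite: Bowditch2000, §1] -/
theorem ravelFam_rel (i : Fin 20) :
    ravelFam (J i) * (ravelFam i)⁻¹ * ravelFam (K i) = ravelFam i := by
  obtain ⟨-, -, hs⟩ := nonExtremal_words i
  have ha : evalHZ (words i) ≠ 0 := evalHZ_ne_zero _
  have hb : evalHZ (words (J i)) ≠ 0 := evalHZ_ne_zero _
  have hc : evalHZ (words (K i)) ≠ 0 := evalHZ_ne_zero _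
  have hsa := star_ne_zero' ha
  have h1 : cls _ (mul_ne_zero' (mul_ne_zero' (mul_ne_zero' hb hsa) hc) hsa) = 1 :=
    cls_eq_one_of_isScalar _ _ hs
  rw [cls_mul _ _ (mul_ne_zero' (mul_ne_zero' hb hsa) hc) hsa, cls_mul _ _ (mul_ne_zero' hb hsa) hc,
    cls_mul _ _ hb hsa, cls_star_eq_inv _ ha] at h1
  -- h1 : B * A⁻¹ * C * A⁻¹ = 1
  exact mul_inv_eq_one.mp h1

/-- `Γ_{3,5}` (the subgroup of `ℍ(ℚ)^×/ℚ^×` generated by Rattaggi's five letters) is NOT diffuse: the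
classes of the 20 words of `Gamma35Ravel.lean` form a ravel inside it.
[cite: Bowditch2000, §1] [cite: Rattaggi2004, Example 28] -/
theorem gamma35_not_diffuse : ¬ Diffuse Gamma35 :=
  not_diffuse_subgroup_of_witnesses Gamma35 ravelFam ravelFam_mem J K ravelFam_ne ravelFam_rel

/-- Consequently `Γ_{3,5}` admits no left-invariant linear order (left-ordered groups are diffuse).
[cite: Bowditch2000, §1] -/
theorem gamma35_not_leftOrdered [LinearOrder Gamma35] : ¬ MulLeftStrictMono Gamma35 :=
  fun _ => gamma35_not_diffuse diffuse_of_mulLeftStrictMono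

end Literature.GroupTheory.ArithmeticGroups.Rattaggi2004
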